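import Literature.MathematicalPhysics.QuantumFieldTheory.Balaban1983to89.T4CouplingMatching

/-!
# EriceRemainderEnclosureHistoryRenewalBlocks — (E33b) the BLOCK RENEWAL across infrared distances: a backward recursion whose rows
# split into a source, a window-independent deletion term and a Lipschitz part over a WINDOW of `s` recent scales is bounded,
# `t` windows deep, by `c∕((1−θ)(1−q))·((2K+1)θ^s + q^t)` — stretched-exponential for `s = t = ⌊√j⌋` (abstract real sequences)

Cell `pub-balaban`, β-function sub-cell, BINDER row D4 «RemainderConst leaves for Bałaban's split» (`HOME/BINDER-OWNERS.md`; owner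
lineage `b2b-balaban-beta-an4`; this file by co-owner #2 lineage `b2b-balaban-beta-d4-p2`, generation 35), β-FLOW TEAM duty (1),
FREEZE (0) honoured (def-free; no leaf, no hypothesis shape, no β: ABSTRACT real sequences only).  The arithmetic half of station (E33)
«is fading memory idle for the continuum coupling too?»; siblings of node U2's arithmetic kernels `T4CouplingMatching.backward_sum` ∕
`twoSided_fixedPoint` (imported for the vocabulary only) and of (E32)'s `rowSum_fixedPoint`.  Consumed by (E33c)
`EriceRemainderEnclosureHistoryRenewalRate` with the row split of (E33a) `EriceRemainderEnclosureHistoryRenewal.disc_row_split`.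

HONEST FRAMING.  [folklore] real analysis; nothing of Bałaban's [I] is quoted, typed or asserted here; row D4 class UNCHANGED
(critical-path width 0; instance 0∕1; D4 DISCHARGE NO DATE); NOT B12 Thm 2, NOT BetaPertH, NOT continuum, NOT Clay.  HONEST DEPENDENCY:
continuum YM on T⁴ ⇐ BetaPertH ∧ nine spine estimates (0/9 proved); BetaPertH ⇐ (D1) ∧ (D4) ∧ CAP+tail; G-an2-4 gates asym, D1 and NE2/3/4.

THE MECHANISM.  Data: `δ ≥ 0` on `[0, K]` with `δ_K = 0` (the infrared pin), weights `w ≥ 0` with `Σ_{j≤K} w_j ≤ U` (node U2's AF weight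
sum), `m ≥ 0` with `q := m·U < 1` (the smallness), sources `a_j ≥ 0`, a deletion term `e ≥ 0`, and the ROW SPLIT
`δ_j ≤ δ_{j+1} + a_j + e + m·w_j·B′` for every bound `B′` of `δ` on the window `[j − s, j]`.  ONE BLOCK (§1 `block_step`): summing the rows
over the last `N` scales, `ε_N ≤ S_N + q·ε_{N+s}` (`ε_N` = max of `δ` at infrared distance `≤ N`, `S_N = Σ_{l∈[K−N,K)}(a_l + e)`);
`t` BLOCKS (`block_iterate`): `ε_N ≤ Σ_{τ<t} q^τ S_{N+τs} + q^t·D` for any global bound `D`; the GLOBAL BOUND (§2 `bound_of_split`):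
`D = S₀∕(1−q)` from the undeleted split; the STRETCHED BOUND (§3): with `a_j = cθ^j`, `e = 2cθ^s∕(1−θ)` every block at depth `< t` starts
at least `s` scales from the ultraviolet end when `t·s ≤ j`, so `S ≤ (2K+1)cθ^s∕(1−θ)` and `δ_j ≤ c∕((1−θ)(1−q))·((2K+1)θ^s + q^t)`
(`stretched_of_split`); `s = t = Nat.sqrt j` gives `δ_j ≤ c∕((1−θ)(1−q))·(2K+2)·max(θ,q)^(Nat.sqrt j)` (`stretched_sqrt_of_split`).

WHAT IS PROVED ([folklore]; 0 `def`, 0 sorry): §1 `backward_sum_from`, `block_step`, `block_iterate`; §2 `bound_of_split`;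
§3 `stretched_of_split`, `stretched_sqrt_of_split`.
-/

noncomputable section
open Finset

namespace Summit.QuantumFields.BalabanUV.Beta.EriceRemainderEnclosureHistoryRenewalBlocks

/-! ## §1 The block renewal across infrared distances -/

/-- Backward accumulation on a terminal interval: `δ_K ≤ 0` and `δ_j ≤ δ_{j+1} + s_j` for `J ≤ j < K` give `δ_j ≤ Σ_{i∈[j,K)} s_i` for
`J ≤ j ≤ K`. [folklore] -/
theorem backward_sum_from {K J : ℕ} {δ s : ℕ → ℝ} (hK : δ K ≤ 0)
    (hrec : ∀ j, J ≤ j → j < K → δ j ≤ δ (j + 1) + s j) : ∀ j, J ≤ j → j ≤ K → δ j ≤ ∑ i ∈ Ico j K, s i := by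
  suffices H : ∀ d j, j + d = K → J ≤ j → δ j ≤ ∑ i ∈ Ico j K, s i from
    fun j hJ hj => H (K - j) j (Nat.add_sub_cancel' hj) hJ
  intro d
  induction d with
  | zero => intro j hj _; rw [add_zero] at hj; subst hj; simpa using hK
  | succ d ih =>
    intro j hj hJ
    have hjK : j < K := by omega
    have h1 := hrec j hJ hjK
    have h2 := ih (j + 1) (by omega) (by omega)
    rw [Finset.sum_eq_sum_Ico_succ_bot hjK]
    linarith

/-- **ONE BLOCK**: if `δ_i ≤ B` for all scales `i` at infrared distance `≤ N + s` (`K − (N+s) ≤ i ≤ K`), and every row `j` at infrared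
distance `≤ N` splits as `δ_j ≤ δ_{j+1} + a_j + e + m·w_j·B′` for any bound `B′` of `δ` on `[j − s, j]`, then for every `j` at infrared
distance `≤ N`: `δ_j ≤ Σ_{l∈[K−N,K)} (a_l + e) + m·U·B` (`Σ_{j≤K} w_j ≤ U`, all data nonnegative, `δ_K = 0`) — the renewal inequality
`ε_N ≤ S_N + q·ε_{N+s}`. [folklore] -/
theorem block_step {K N s : ℕ} {δ a w : ℕ → ℝ} {e m U B : ℝ}
    (hw : ∀ i, i ≤ K → 0 ≤ w i) (hm : 0 ≤ m) (he : 0 ≤ e) (ha : ∀ i, 0 ≤ a i)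
    (hU : ∑ j ∈ range (K + 1), w j ≤ U) (hK : δ K = 0) (hB : 0 ≤ B)
    (hrec : ∀ j, K - N ≤ j → j < K → ∀ B' : ℝ, (∀ i, j - s ≤ i → i ≤ j → δ i ≤ B') → δ j ≤ δ (j + 1) + a j + e + m * w j * B')
    (hbound : ∀ i, K - (N + s) ≤ i → i ≤ K → δ i ≤ B) :
    ∀ j, K - N ≤ j → j ≤ K → δ j ≤ (∑ l ∈ Ico (K - N) K, (a l + e)) + m * U * B := by
  have hstep : ∀ j, K - N ≤ j → j < K → δ j ≤ δ (j + 1) + (a j + e + m * w j * B) := by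
    intro j hJ hjK
    have h := hrec j hJ hjK B (fun i hi1 hi2 => hbound i (by omega) (by omega))
    linarith
  intro j hJ hjK
  have h1 := backward_sum_from (s := fun l => a l + e + m * w l * B) (le_of_eq hK) hstep j hJ hjK
  have h2 : ∑ i ∈ Ico j K, (a i + e + m * w i * B) = (∑ i ∈ Ico j K, (a i + e)) + m * B * ∑ i ∈ Ico j K, w i := by
    rw [sum_add_distrib, mul_sum]; exact congrArg _ (sum_congr rfl fun i _ => by ring)
  have h3 : ∑ i ∈ Ico j K, (a i + e) ≤ ∑ l ∈ Ico (K - N) K, (a l + e) :=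
    sum_le_sum_of_subset_of_nonneg (Ico_subset_Ico hJ le_rfl) fun l _ _ => add_nonneg (ha l) he
  have h4 : ∑ i ∈ Ico j K, w i ≤ U :=
    (sum_le_sum_of_subset_of_nonneg (fun i hi => mem_range.mpr (by have := (mem_Ico.mp hi).2; omega))
      (fun i hi _ => hw i (Nat.lt_succ_iff.mp (mem_range.mp hi)))).trans hU
  have h5 : m * B * ∑ i ∈ Ico j K, w i ≤ m * B * U := mul_le_mul_of_nonneg_left h4 (mul_nonneg hm hB)
  calc δ j ≤ ∑ i ∈ Ico j K, (a i + e + m * w i * B) := h1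
    _ = (∑ i ∈ Ico j K, (a i + e)) + m * B * ∑ i ∈ Ico j K, w i := h2
    _ ≤ (∑ l ∈ Ico (K - N) K, (a l + e)) + m * U * B := by nlinarith [h3, h5]

/-- **THE t-FOLD RENEWAL**: with `S N := Σ_{l∈[K−N,K)} (a_l + e)` and `q := m·U`, if `0 ≤ δ ≤ D` on `[0, K]` then for every `t` and `N`:
`δ_j ≤ Σ_{τ<t} q^τ·S(N + τ·s) + q^t·D` for all `j` at infrared distance `≤ N`. [folklore] -/
theorem block_iterate {K s : ℕ} {δ a w : ℕ → ℝ} {e m U D : ℝ}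
    (hw : ∀ i, i ≤ K → 0 ≤ w i) (hm : 0 ≤ m) (he : 0 ≤ e) (ha : ∀ i, 0 ≤ a i)
    (hU : ∑ j ∈ range (K + 1), w j ≤ U) (hU0 : 0 ≤ U) (hK : δ K = 0) (hD : 0 ≤ D) (hδD : ∀ i, i ≤ K → δ i ≤ D)
    (hrec : ∀ j, j < K → ∀ B' : ℝ, (∀ i, j - s ≤ i → i ≤ j → δ i ≤ B') → δ j ≤ δ (j + 1) + a j + e + m * w j * B') :
    ∀ t N j, K - N ≤ j → j ≤ K →
      δ j ≤ (∑ τ ∈ range t, (m * U) ^ τ * ∑ l ∈ Ico (K - (N + τ * s)) K, (a l + e)) + (m * U) ^ t * D := by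
  have hS0 : ∀ N', 0 ≤ ∑ l ∈ Ico (K - N') K, (a l + e) := fun N' => sum_nonneg fun l _ => add_nonneg (ha l) he
  intro t
  induction t with
  | zero => intro N j _ hjK; simpa using hδD j hjK
  | succ t ih =>
    intro N j hJ hjK
    set B := (∑ τ ∈ range t, (m * U) ^ τ * ∑ l ∈ Ico (K - (N + s + τ * s)) K, (a l + e)) + (m * U) ^ t * D with hBdef
    have hB : 0 ≤ B := add_nonneg (sum_nonneg fun τ _ => mul_nonneg (pow_nonneg (mul_nonneg hm hU0) τ) (hS0 _))
      (mul_nonneg (pow_nonneg (mul_nonneg hm hU0) t) hD)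
    have hblock := block_step (N := N) (s := s) hw hm he ha hU hK hB (fun j hJ' hjK' B' hB' => hrec j hjK' B' hB')
      (fun i hi1 hi2 => ih (N + s) i (by omega) hi2) j hJ hjK
    have e1 : (∑ τ ∈ range (t + 1), (m * U) ^ τ * ∑ l ∈ Ico (K - (N + τ * s)) K, (a l + e)) + (m * U) ^ (t + 1) * D
        = (∑ l ∈ Ico (K - N) K, (a l + e)) + m * U * B := by
      have e2 : ∀ τ, N + (τ + 1) * s = N + s + τ * s := fun τ => by ring
      rw [sum_range_succ', pow_zero, one_mul, Nat.zero_mul, Nat.add_zero, hBdef, mul_add, mul_sum]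
      have e3 : ∀ τ ∈ range t, (m * U) ^ (τ + 1) * ∑ l ∈ Ico (K - (N + (τ + 1) * s)) K, (a l + e)
          = m * U * ((m * U) ^ τ * ∑ l ∈ Ico (K - (N + s + τ * s)) K, (a l + e)) := by
        intro τ _; rw [e2 τ, pow_succ]; ring
      rw [sum_congr rfl e3, pow_succ]; ring
    rw [e1]; exact hblock

/-! ## §2 The global bound (row-sum fixed point WITH source) -/

/-- **THE GLOBAL BOUND**: if `δ ≥ 0`, `δ_K = 0`, every row splits WITHOUT deletion as `δ_j ≤ δ_{j+1} + a_j + m·w_j·B′` for any bound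
`B′` of `δ` on `[0, j]`, `Σ_{l<K} a_l ≤ S₀`, `Σ_{j≤K} w_j ≤ U` and `q = m·U < 1`, then `δ_i ≤ S₀∕(1 − q)` for every `i ≤ K` (apply the
one-block inequality to `B = max δ` and absorb). [folklore] -/
theorem bound_of_split {K : ℕ} {δ a w : ℕ → ℝ} {m U S₀ : ℝ}
    (hw : ∀ i, i ≤ K → 0 ≤ w i) (hm : 0 ≤ m) (ha : ∀ i, 0 ≤ a i)
    (hU : ∑ j ∈ range (K + 1), w j ≤ U) (hq : m * U < 1) (hK : δ K = 0) (hδ : ∀ i, 0 ≤ δ i)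
    (hS₀ : ∑ l ∈ range K, a l ≤ S₀)
    (hrec₀ : ∀ j, j < K → ∀ B' : ℝ, (∀ i, i ≤ j → δ i ≤ B') → δ j ≤ δ (j + 1) + a j + m * w j * B') :
    ∀ i, i ≤ K → δ i ≤ S₀ / (1 - m * U) := by
  have hne : (range (K + 1)).Nonempty := ⟨0, by simp⟩
  set B := (range (K + 1)).sup' hne δ with hBdef
  have hBi : ∀ i, i ≤ K → δ i ≤ B := fun i hi => Finset.le_sup' δ (mem_range.mpr (Nat.lt_succ_of_le hi))
  have hB0 : 0 ≤ B := (hδ 0).trans (hBi 0 (Nat.zero_le K))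
  have hblock := block_step (N := K) (s := K) (e := 0) (a := a) hw hm le_rfl ha hU hK hB0
    (fun j _ hjK B' hB' => by
      have h := hrec₀ j hjK B' (fun i hi => hB' i (by omega) hi)
      linarith)
    (fun i _ hi => hBi i hi)
  obtain ⟨i₀, hi₀, hBi₀⟩ := Finset.exists_mem_eq_sup' hne δ
  have hi₀K : i₀ ≤ K := Nat.lt_succ_iff.mp (mem_range.mp hi₀)
  have hBle : B ≤ S₀ + m * U * B := by
    have h := hblock i₀ (by omega) hi₀K
    rw [Nat.sub_self] at h
    have e : ∑ l ∈ Ico 0 K, (a l + 0) = ∑ l ∈ range K, a l := by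
      rw [Nat.Ico_zero_eq_range]; exact sum_congr rfl fun l _ => add_zero _
    rw [e, ← hBi₀] at h
    linarith
  have h1q : 0 < 1 - m * U := by linarith
  have hBfin : B ≤ S₀ / (1 - m * U) := by
    rw [le_div_iff₀ h1q]; nlinarith
  exact fun i hi => (hBi i hi).trans hBfin

/-! ## §3 The stretched bound -/

/-- **THE RENEWED BOUND, FREE WINDOW AND DEPTH** (abstract).  `0 ≤ θ < 1`, `c ≥ 0`, weights `w ≥ 0` with `Σ_{j≤K} w_j ≤ U`, `m ≥ 0`,
`q = m·U < 1`, `δ ≥ 0`, `δ_K = 0`; every row splits without deletion (`a_j = cθ^j`) and, for the window `s`, with the deletion term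
`e = 2cθ^s∕(1−θ)`.  THEN for every scale `j ≤ K` and every depth `t` with `t·s ≤ j`, `1 ≤ s`:
`δ_j ≤ c∕((1−θ)(1−q)) · ((2K+1)·θ^s + q^t)`.  (§2 gives `D = c∕((1−θ)(1−q))`; `t` renewals of §1 from infrared distance `K − j`, each
block's source `≤ cθ^s∕(1−θ) + K·e` because its rows start at least `s` scales from the ultraviolet end.) [folklore] -/
theorem stretched_of_split {K s t j₀ : ℕ} {δ w : ℕ → ℝ} {c θ m U : ℝ}
    (hθ0 : 0 ≤ θ) (hθ1 : θ < 1) (hc : 0 ≤ c) (hw : ∀ i, i ≤ K → 0 ≤ w i) (hm : 0 ≤ m)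
    (hU : ∑ j ∈ range (K + 1), w j ≤ U) (hU0 : 0 ≤ U) (hq : m * U < 1) (hK : δ K = 0) (hδ : ∀ i, 0 ≤ δ i)
    (hrec₀ : ∀ j, j < K → ∀ B' : ℝ, (∀ i, i ≤ j → δ i ≤ B') → δ j ≤ δ (j + 1) + c * θ ^ j + m * w j * B')
    (hrec : ∀ j, j < K → ∀ B' : ℝ, (∀ i, j - s ≤ i → i ≤ j → δ i ≤ B') →
      δ j ≤ δ (j + 1) + c * θ ^ j + 2 * (c * θ ^ s / (1 - θ)) + m * w j * B')
    (hj₀ : j₀ ≤ K) (hs : 1 ≤ s) (hts : t * s ≤ j₀) :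
    δ j₀ ≤ c / ((1 - θ) * (1 - m * U)) * ((2 * K + 1) * θ ^ s + (m * U) ^ t) := by
  have h1θ : 0 < 1 - θ := by linarith
  have h1q : 0 < 1 - m * U := by linarith
  have hq0 : 0 ≤ m * U := mul_nonneg hm hU0
  -- the geometric source sums
  have hgeomL : ∀ L, L ≤ K → ∑ l ∈ Ico L K, c * θ ^ l ≤ c * θ ^ L / (1 - θ) := by
    intro L _
    rw [← mul_sum]
    calc c * ∑ l ∈ Ico L K, θ ^ l ≤ c * (θ ^ L / (1 - θ)) := mul_le_mul_of_nonneg_left (geom_sum_Ico_le_of_lt_one hθ0 hθ1) hc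
      _ = c * θ ^ L / (1 - θ) := by ring
  -- §2: the global bound D
  set D := c / (1 - θ) / (1 - m * U) with hDdef
  have hS₀ : ∑ l ∈ range K, c * θ ^ l ≤ c / (1 - θ) := by
    have h := hgeomL 0 (Nat.zero_le K)
    rw [Nat.Ico_zero_eq_range, pow_zero, mul_one] at h
    exact h
  have hD := bound_of_split (a := fun l => c * θ ^ l) hw hm (fun i => mul_nonneg hc (pow_nonneg hθ0 i)) hU hq hK hδ hS₀ hrec₀
  have hD0 : 0 ≤ D := div_nonneg (div_nonneg hc h1θ.le) h1q.le
  -- §1: t renewals from infrared distance N = K - j₀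
  set e := 2 * (c * θ ^ s / (1 - θ)) with hedef
  have he : 0 ≤ e := by positivity
  have hit := block_iterate (a := fun l => c * θ ^ l) (e := e) hw hm he (fun i => mul_nonneg hc (pow_nonneg hθ0 i)) hU hU0 hK
    hD0 hD (fun j hj B' hB' => hrec j hj B' hB') t (K - j₀) j₀ (by omega) hj₀
  -- each block's source
  have hblock : ∀ τ ∈ range t, ∑ l ∈ Ico (K - (K - j₀ + τ * s)) K, (c * θ ^ l + e) ≤ (2 * K + 1) * (c * θ ^ s / (1 - θ)) := by
    intro τ hτ
    have hτt : τ + 1 ≤ t := mem_range.mp hτ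
    have hτs : (τ + 1) * s ≤ j₀ := (Nat.mul_le_mul_right s hτt).trans hts
    rw [Nat.succ_mul] at hτs
    have hx : K - j₀ + τ * s ≤ K - s := by omega
    set L := K - (K - j₀ + τ * s) with hL
    have hLs : s ≤ L := by omega
    have hLK : L ≤ K := Nat.sub_le _ _
    rw [sum_add_distrib, sum_const, Nat.card_Ico, nsmul_eq_mul]
    have hcard : ((K - L : ℕ) : ℝ) ≤ K := by exact_mod_cast Nat.sub_le K L
    have h1 : ∑ l ∈ Ico L K, c * θ ^ l ≤ c * θ ^ s / (1 - θ) := by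
      refine (hgeomL L hLK).trans ?_
      have : θ ^ L ≤ θ ^ s := pow_le_pow_of_le_one hθ0 hθ1.le hLs
      exact div_le_div_of_nonneg_right (mul_le_mul_of_nonneg_left this hc) h1θ.le
    have h2 : ((K - L : ℕ) : ℝ) * e ≤ K * e := mul_le_mul_of_nonneg_right hcard he
    calc ∑ l ∈ Ico L K, c * θ ^ l + ((K - L : ℕ) : ℝ) * e ≤ c * θ ^ s / (1 - θ) + K * e := add_le_add h1 h2
      _ = (2 * K + 1) * (c * θ ^ s / (1 - θ)) := by rw [hedef]; ring
  have hgeomq : ∑ τ ∈ range t, (m * U) ^ τ ≤ 1 / (1 - m * U) := by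
    rw [le_div_iff₀ h1q, geom_sum_mul_neg]
    linarith [pow_nonneg hq0 t]
  have hmain : ∑ τ ∈ range t, (m * U) ^ τ * ∑ l ∈ Ico (K - (K - j₀ + τ * s)) K, (c * θ ^ l + e)
      ≤ (2 * K + 1) * (c * θ ^ s / (1 - θ)) * (1 / (1 - m * U)) := by
    calc ∑ τ ∈ range t, (m * U) ^ τ * ∑ l ∈ Ico (K - (K - j₀ + τ * s)) K, (c * θ ^ l + e)
        ≤ ∑ τ ∈ range t, (m * U) ^ τ * ((2 * K + 1) * (c * θ ^ s / (1 - θ))) :=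
          sum_le_sum fun τ hτ => mul_le_mul_of_nonneg_left (hblock τ hτ) (pow_nonneg hq0 τ)
      _ = (2 * K + 1) * (c * θ ^ s / (1 - θ)) * ∑ τ ∈ range t, (m * U) ^ τ := by rw [← sum_mul]; ring
      _ ≤ (2 * K + 1) * (c * θ ^ s / (1 - θ)) * (1 / (1 - m * U)) :=
          mul_le_mul_of_nonneg_left hgeomq (by positivity)
  calc δ j₀ ≤ (∑ τ ∈ range t, (m * U) ^ τ * ∑ l ∈ Ico (K - (K - j₀ + τ * s)) K, (c * θ ^ l + e)) + (m * U) ^ t * D := hit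
    _ ≤ (2 * K + 1) * (c * θ ^ s / (1 - θ)) * (1 / (1 - m * U)) + (m * U) ^ t * D := by linarith
    _ = c / ((1 - θ) * (1 - m * U)) * ((2 * K + 1) * θ ^ s + (m * U) ^ t) := by
        rw [hDdef]
        field_simp

/-- **THE STRETCHED-EXPONENTIAL FORM** (abstract): under the hypotheses of `stretched_of_split` (for the window `s = Nat.sqrt j₀`), for
every `j₀ ≤ K`: `δ_{j₀} ≤ c∕((1−θ)(1−q))·(2K+2)·max(θ,q)^(Nat.sqrt j₀)` — window and depth `⌊√j₀⌋` (`⌊√j₀⌋² ≤ j₀`); for `j₀ = 0` the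
global bound. [folklore] -/
theorem stretched_sqrt_of_split {K j₀ : ℕ} {δ w : ℕ → ℝ} {c θ m U : ℝ}
    (hθ0 : 0 ≤ θ) (hθ1 : θ < 1) (hc : 0 ≤ c) (hw : ∀ i, i ≤ K → 0 ≤ w i) (hm : 0 ≤ m)
    (hU : ∑ j ∈ range (K + 1), w j ≤ U) (hU0 : 0 ≤ U) (hq : m * U < 1) (hK : δ K = 0) (hδ : ∀ i, 0 ≤ δ i)
    (hrec₀ : ∀ j, j < K → ∀ B' : ℝ, (∀ i, i ≤ j → δ i ≤ B') → δ j ≤ δ (j + 1) + c * θ ^ j + m * w j * B')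
    (hrec : ∀ j, j < K → ∀ B' : ℝ, (∀ i, j - Nat.sqrt j₀ ≤ i → i ≤ j → δ i ≤ B') →
      δ j ≤ δ (j + 1) + c * θ ^ j + 2 * (c * θ ^ Nat.sqrt j₀ / (1 - θ)) + m * w j * B')
    (hj₀ : j₀ ≤ K) :
    δ j₀ ≤ c / ((1 - θ) * (1 - m * U)) * (2 * K + 2) * (max θ (m * U)) ^ Nat.sqrt j₀ := by
  have h1θ : 0 < 1 - θ := by linarith
  have h1q : 0 < 1 - m * U := by linarith
  have hq0 : 0 ≤ m * U := mul_nonneg hm hU0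
  have hr0 : 0 ≤ max θ (m * U) := hθ0.trans (le_max_left _ _)
  have hD0 : 0 ≤ c / ((1 - θ) * (1 - m * U)) := div_nonneg hc (mul_pos h1θ h1q).le
  have hK0 : (0 : ℝ) ≤ K := Nat.cast_nonneg K
  rcases Nat.eq_zero_or_pos (Nat.sqrt j₀) with hs0 | hs
  · -- global bound
    rw [hs0, pow_zero, mul_one]
    have hS₀ : ∑ l ∈ range K, c * θ ^ l ≤ c / (1 - θ) := by
      rw [← mul_sum]
      calc c * ∑ l ∈ range K, θ ^ l ≤ c * (θ ^ 0 / (1 - θ)) := by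
            rw [← Nat.Ico_zero_eq_range]; exact mul_le_mul_of_nonneg_left (geom_sum_Ico_le_of_lt_one hθ0 hθ1) hc
        _ = c / (1 - θ) := by rw [pow_zero]; ring
    have hD := bound_of_split (a := fun l => c * θ ^ l) hw hm (fun i => mul_nonneg hc (pow_nonneg hθ0 i)) hU hq hK hδ hS₀ hrec₀
      j₀ hj₀
    calc δ j₀ ≤ c / (1 - θ) / (1 - m * U) := hD
      _ = c / ((1 - θ) * (1 - m * U)) * 1 := by rw [div_div, mul_one]
      _ ≤ c / ((1 - θ) * (1 - m * U)) * (2 * K + 2) := mul_le_mul_of_nonneg_left (by linarith) hD0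
  · have hmain := stretched_of_split (s := Nat.sqrt j₀) (t := Nat.sqrt j₀) hθ0 hθ1 hc hw hm hU hU0 hq hK hδ hrec₀ hrec hj₀ hs
      (Nat.sqrt_le j₀)
    have hθr : θ ^ Nat.sqrt j₀ ≤ (max θ (m * U)) ^ Nat.sqrt j₀ := pow_le_pow_left₀ hθ0 (le_max_left _ _) _
    have hqr : (m * U) ^ Nat.sqrt j₀ ≤ (max θ (m * U)) ^ Nat.sqrt j₀ := pow_le_pow_left₀ hq0 (le_max_right _ _) _
    calc δ j₀ ≤ c / ((1 - θ) * (1 - m * U)) * ((2 * K + 1) * θ ^ Nat.sqrt j₀ + (m * U) ^ Nat.sqrt j₀) := hmain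
      _ ≤ c / ((1 - θ) * (1 - m * U)) * ((2 * K + 1) * (max θ (m * U)) ^ Nat.sqrt j₀ + (max θ (m * U)) ^ Nat.sqrt j₀) := by
          refine mul_le_mul_of_nonneg_left (add_le_add (mul_le_mul_of_nonneg_left hθr (by linarith)) hqr) hD0
      _ = c / ((1 - θ) * (1 - m * U)) * (2 * K + 2) * (max θ (m * U)) ^ Nat.sqrt j₀ := by ring

end Summit.QuantumFields.BalabanUV.Beta.EriceRemainderEnclosureHistoryRenewalBlocks

end
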